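import Mathlib
import Summits.Schanuel.Schanuel.Theorems.AclSubsetLogFreeCore.Negative.CoreAutRigidity

/-!
# Crux `AclSubsetLogFreeCore` — the residue stub needs a WILD automorphism of the countable core

Drefute (gen 2) findings for line `eac-extends-core-automorphisms` of crux stmt-Schanuel-0968, about
its hardest stub

  `stub_coreFixedField_logFree : ∀ a ∈ ecl ∅, (∀ g, IsEIsoOn g (ecl ∅) (ecl ∅) → g a = a) → a ∈ logFreeCore`

(`C₀ := ecl ∅`, the countable field of exponentially algebraic numbers; `C_EA := logFreeCore`).
All statements below are PROVED (no `sorry`); they do not refute the stub (it is consistent relative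
to Zilber's conjecture) but pin down exactly what a proof must contain.

* §1 `C₀` and `C_EA` are closed under real and imaginary parts (`ofReal_re_mem_ecl_empty`, …),
  `C_EA ⊆ C₀` (`logFreeCore_subset_ecl_empty`), and `C₀ ⊆ C_EA` is decided on REAL elements
  (`ecl_subset_logFreeCore_iff_real`).
* §2 **Tame core automorphisms are trivial.** A core automorphism `g` (any `g : ℂ → ℂ` with
  `IsEIsoOn g (ecl ∅) (ecl ∅)`) that maps the real elements of `C₀` to real numbers is `id` or
  `conj` on `C₀` (`coreAut_eqOn_id_or_conj_of_real`): it preserves squares of reals of the real-closed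
  field `C₀ ∩ ℝ`, hence the order, hence fixes `C₀ ∩ ℝ` pointwise by density of `ℚ`; then
  `g i = ±i` (`coreAut_map_two_pi_I_and_map_I`) decides between `id` and `conj`.  So every core
  automorphism other than `id`, `conj` is WILD: it sends some real exponentially-algebraic number to a
  non-real one (`coreAut_rigid_or_exists_wild`).
* §3 **Rigidity dichotomy.** If `Aut_E(C₀) = {id, conj}` on `C₀` (no wild automorphism — the present
  state of knowledge, `CoreAutConj`), the residue stub is EQUIVALENT to `ecl ∅ ⊆ logFreeCore`, i.e. to
  `C₀ = C_EA`, "every exponentially algebraic number is log-free" (`stubCoreFixedField_iff_of_rigid`);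
  unconditionally the stub implies `C₀ = C_EA ∨ ∃ wild core automorphism`
  (`ecl_subset_logFreeCore_or_exists_wild_of_stub`).
* §4 The first alternative is false under Schanuel's conjecture, with an explicit witness that this
  file places in `C₀`: the real solution `x₀ = -Ω = -0.5671…` of `eˣ = -x`
  (`exists_real_exp_add_self_eq_zero_mem_ecl_empty`; one-unknown Khovanskii system `Y + X = 0`,
  Jacobian `1 + eˣ ≠ 0`).  PAPER (SC ⇒ `x₀ ∉ K_ω = C_EA`): if `x₀ ∈ K_ω` pick `t = 2πi, w₁, …, w_N`
  `ℚ`-linearly independent with each `w_j` algebraic over `ℚ(t, w_{<j}, e^{w_{<j}})` and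
  `x₀ ∈ ℚ(t, w̄, e^{w̄})^{alg}`; if `x₀ ∉ span_ℚ(t, w̄)`, SC for `(t, w̄, x₀)` demands transcendence
  degree `≥ N + 2` of a field of transcendence degree `≤ N + 1`; if `x₀ = q₀t + Σ qⱼwⱼ` with `j`
  maximal such that `q_j ≠ 0`, the equation `e^{x₀} = -x₀` makes `e^{w_j}` algebraic over
  `ℚ(t, w_{<j}, e^{w_{<j}}, w_j)`, so SC for `(t, w̄)` fails; `x₀ = q₀ t` is impossible as `x₀` is
  real and non-zero.  Hence, granting SC, **any proof of the residue stub constructs an E-field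
  automorphism of the countable field `C₀` which maps a real number to a non-real number** — no
  automorphism of `C₀` (or of `ℂ_exp`) other than `id`, `conj` is presently known, and one moving
  `ln 2` already yields the algebraic independence of `π` and `ln 2` (route support
  `EndomorphismMovingLogTwo`).  Under Zilber's conjecture (`⟺ SC ∧ SEAC`, Bays–Kirby 2018 Thm 1.4)
  such automorphisms exist (`C₀ ≅ B₀` is homogeneous over the standard kernel, Kirby FPEF §6), so no
  refutation is to be expected either: the stub is exactly as hard as producing wild symmetries of `C₀`.
-/

noncomputable section

set_option linter.dupNamespace false

open Literature.ModelTheory.ExponentialFields Literature.NumberTheory.Transcendental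
open MvPolynomial

namespace Summit.Schanuel.Schanuel.Theorems.AclSubsetLogFreeCore.Negative

/-! ## §1 Real and imaginary parts; `C_EA ⊆ C₀`; reality reduction of `C₀ ⊆ C_EA` -/

/-- `C₀` is closed under subtraction. -/
theorem sub_mem_ecl_empty {a b : ℂ} (ha : a ∈ ecl (∅ : Set ℂ)) (hb : b ∈ ecl (∅ : Set ℂ)) :
    a - b ∈ ecl (∅ : Set ℂ) := by
  rw [sub_eq_add_neg]; exact Khovanskii.add_mem_ecl ha (Khovanskii.neg_mem_ecl hb)

/-- The real part of an exponentially algebraic number is exponentially algebraic. -/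
theorem ofReal_re_mem_ecl_empty {a : ℂ} (ha : a ∈ ecl (∅ : Set ℂ)) :
    ((a.re : ℝ) : ℂ) ∈ ecl (∅ : Set ℂ) := by
  have h : ((a.re : ℝ) : ℂ) = ((1 / 2 : ℚ) : ℂ) * (a + (starRingEnd ℂ) a) := by
    rw [Complex.add_conj]; push_cast; ring
  rw [h]
  exact Khovanskii.mul_mem_ecl (ratCast_mem_ecl_empty _)
    (Khovanskii.add_mem_ecl ha (conj_mem_ecl_empty ha))

/-- The imaginary part of an exponentially algebraic number is exponentially algebraic. -/
theorem ofReal_im_mem_ecl_empty {a : ℂ} (ha : a ∈ ecl (∅ : Set ℂ)) :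
    ((a.im : ℝ) : ℂ) ∈ ecl (∅ : Set ℂ) := by
  have h : ((a.im : ℝ) : ℂ) = ((-1 / 2 : ℚ) : ℂ) * Complex.I * (a - (starRingEnd ℂ) a) := by
    rw [Complex.sub_conj]; push_cast
    linear_combination ((a.im : ℝ) : ℂ) * Complex.I_mul_I
  rw [h]
  exact Khovanskii.mul_mem_ecl (Khovanskii.mul_mem_ecl (ratCast_mem_ecl_empty _) I_mem_ecl_empty)
    (sub_mem_ecl_empty ha (conj_mem_ecl_empty ha))

/-- `i ∈ C_EA` (it is algebraic). -/
theorem I_mem_logFreeCore : Complex.I ∈ logFreeCore := by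
  refine logFreeCore_mem_coreFamily.2.2 _ ⟨Polynomial.X ^ 2 + 1, ?_, by simp⟩
  exact (Polynomial.monic_X_pow_add_C (1 : logFreeCore) two_ne_zero).ne_zero

/-- `C_EA` is closed under real parts (it is `conj`-stable). -/
theorem ofReal_re_mem_logFreeCore {a : ℂ} (ha : a ∈ logFreeCore) :
    ((a.re : ℝ) : ℂ) ∈ logFreeCore := by
  have h : ((a.re : ℝ) : ℂ) = (a + (starRingEnd ℂ) a) / 2 := by
    rw [Complex.add_conj]; push_cast; ring
  rw [h]
  exact div_mem (add_mem ha (conj_mem_logFreeCore ha)) (by simp)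

/-- `C_EA` is closed under imaginary parts. -/
theorem ofReal_im_mem_logFreeCore {a : ℂ} (ha : a ∈ logFreeCore) :
    ((a.im : ℝ) : ℂ) ∈ logFreeCore := by
  have h : ((a.im : ℝ) : ℂ) = (a - (starRingEnd ℂ) a) / (2 * Complex.I) := by
    rw [eq_div_iff (mul_ne_zero two_ne_zero Complex.I_ne_zero), Complex.sub_conj]
    push_cast; ring
  rw [h]
  exact div_mem (sub_mem ha (conj_mem_logFreeCore ha)) (mul_mem (by simp) I_mem_logFreeCore)

/-- Membership in `C_EA` is decided by the real and imaginary parts. -/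
theorem mem_logFreeCore_of_re_im {a : ℂ} (hre : ((a.re : ℝ) : ℂ) ∈ logFreeCore)
    (him : ((a.im : ℝ) : ℂ) ∈ logFreeCore) : a ∈ logFreeCore := by
  rw [← Complex.re_add_im a]
  exact add_mem hre (mul_mem him I_mem_logFreeCore)

/-- **`C_EA ⊆ C₀`**: the countable core is an `exp`-closed, relatively algebraically closed subfield
containing `2πi`, i.e. a member of the family whose infimum is `C_EA`. -/
theorem logFreeCore_subset_ecl_empty : (logFreeCore : Set ℂ) ⊆ ecl (∅ : Set ℂ) := by
  let E : IntermediateField ℚ ℂ :=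
    (Khovanskii.eclSubfield (∅ : Set ℂ)).toIntermediateField fun q => by simp
  have hE : E ∈ coreFamily := by
    refine ⟨two_pi_I_mem_ecl_empty, fun w hw => cexp_mem_ecl_empty hw, fun w hw => ?_⟩
    obtain ⟨p, hp0, hpw⟩ := hw
    have hne : p.map (algebraMap E ℂ) ≠ 0 :=
      (Polynomial.map_ne_zero_iff (algebraMap E ℂ).injective).2 hp0
    refine Khovanskii.mem_ecl_of_isRoot hne (fun n => ?_) ?_
    · rw [Polynomial.coeff_map]; exact (p.coeff n).2
    · rw [Polynomial.IsRoot.def, Polynomial.eval_map, ← Polynomial.aeval_def]; exact hpw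
  intro x hx
  exact logFreeCore_le_of_mem hE hx

/-- `C₀ ⊆ C_EA` as soon as the REAL exponentially algebraic numbers are log-free. -/
theorem ecl_subset_logFreeCore_iff_real :
    ecl (∅ : Set ℂ) ⊆ (logFreeCore : Set ℂ) ↔
      ∀ a ∈ ecl (∅ : Set ℂ), a.im = 0 → a ∈ logFreeCore := by
  refine ⟨fun h a ha _ => h ha, fun h a ha => ?_⟩
  exact mem_logFreeCore_of_re_im (h _ (ofReal_re_mem_ecl_empty ha) (Complex.ofReal_im _))
    (h _ (ofReal_im_mem_ecl_empty ha) (Complex.ofReal_im _))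

/-- `C₀ ⊆ C_EA` means `C₀ = C_EA`. -/
theorem ecl_subset_logFreeCore_iff_eq :
    ecl (∅ : Set ℂ) ⊆ (logFreeCore : Set ℂ) ↔ ecl (∅ : Set ℂ) = (logFreeCore : Set ℂ) :=
  ⟨fun h => Set.Subset.antisymm h logFreeCore_subset_ecl_empty, fun h => h.le⟩

/-! ## §2 Tame core automorphisms are `id` or `conj` -/

section CoreAut

variable {g : ℂ → ℂ}

/-- Square roots of non-negative reals of `C₀` lie in `C₀` (relative algebraic closedness). -/
theorem ofReal_sqrt_mem_ecl_empty {x : ℝ} (hx : (x : ℂ) ∈ ecl (∅ : Set ℂ)) (h0 : 0 ≤ x) :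
    ((Real.sqrt x : ℝ) : ℂ) ∈ ecl (∅ : Set ℂ) := by
  refine Khovanskii.mem_ecl_of_isRoot (p := Polynomial.X ^ 2 - Polynomial.C (x : ℂ)) ?_ ?_ ?_
  · exact (Polynomial.monic_X_pow_sub_C (x : ℂ) two_ne_zero).ne_zero
  · intro n
    rw [Polynomial.coeff_sub, Polynomial.coeff_X_pow, Polynomial.coeff_C]
    refine sub_mem_ecl_empty ?_ ?_
    · split_ifs
      exacts [Khovanskii.one_mem_ecl _, Khovanskii.zero_mem_ecl _]
    · split_ifs
      exacts [hx, Khovanskii.zero_mem_ecl _]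
  · rw [Polynomial.IsRoot.def, Polynomial.eval_sub, Polynomial.eval_pow, Polynomial.eval_X,
      Polynomial.eval_C, ← Complex.ofReal_pow, Real.sq_sqrt h0, sub_self]

/-- A core automorphism mapping real elements of `C₀` to reals maps non-negative reals of `C₀` to
non-negative reals (it preserves squares). -/
theorem coreAut_re_nonneg_of_real (hg : IsEIsoOn g (ecl (∅ : Set ℂ)) (ecl (∅ : Set ℂ)))
    (hreal : ∀ x : ℝ, (x : ℂ) ∈ ecl (∅ : Set ℂ) → (g x).im = 0)
    {x : ℝ} (hx : (x : ℂ) ∈ ecl (∅ : Set ℂ)) (h0 : 0 ≤ x) : 0 ≤ (g x).re := by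
  have hs := ofReal_sqrt_mem_ecl_empty hx h0
  have hsq : (x : ℂ) = (Real.sqrt x : ℂ) * (Real.sqrt x : ℂ) := by
    rw [← Complex.ofReal_mul, Real.mul_self_sqrt h0]
  have hw : g (Real.sqrt x : ℂ) = (((g (Real.sqrt x : ℂ)).re : ℝ) : ℂ) :=
    Complex.ext (by simp) (by simp [hreal _ hs])
  rw [hsq, hg.map_mul hs hs, hw, ← Complex.ofReal_mul, Complex.ofReal_re]
  exact mul_self_nonneg _

/-- A core automorphism mapping real elements of `C₀` to reals FIXES every real element of `C₀`
(order preservation and density of `ℚ`). -/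
theorem coreAut_ofReal_eq_self_of_real (hg : IsEIsoOn g (ecl (∅ : Set ℂ)) (ecl (∅ : Set ℂ)))
    (hreal : ∀ x : ℝ, (x : ℂ) ∈ ecl (∅ : Set ℂ) → (g x).im = 0)
    {x : ℝ} (hx : (x : ℂ) ∈ ecl (∅ : Set ℂ)) : g x = x := by
  have hq : ∀ q : ℚ, ((q : ℝ) : ℂ) ∈ ecl (∅ : Set ℂ) := fun q => by
    simpa using ratCast_mem_ecl_empty q
  have hgq : ∀ q : ℚ, g ((q : ℝ) : ℂ) = ((q : ℝ) : ℂ) := fun q => by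
    simpa using coreAut_map_ratCast hg q
  -- `g` is monotone against rational bounds
  have hlow : ∀ q : ℚ, (q : ℝ) ≤ x → (q : ℝ) ≤ (g x).re := by
    intro q hqx
    have hmem : (((x - q : ℝ)) : ℂ) ∈ ecl (∅ : Set ℂ) := by
      rw [Complex.ofReal_sub]; exact sub_mem_ecl_empty hx (hq q)
    have h := coreAut_re_nonneg_of_real hg hreal hmem (sub_nonneg.2 hqx)
    have hgx : g ((x - q : ℝ) : ℂ) = g x - ((q : ℝ) : ℂ) := by
      rw [Complex.ofReal_sub, sub_eq_add_neg, hg.map_add hx (Khovanskii.neg_mem_ecl (hq q)),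
        hg.map_neg (hq q), hgq q, ← sub_eq_add_neg]
    rw [hgx, Complex.sub_re, Complex.ofReal_re] at h
    linarith
  have hupp : ∀ q : ℚ, x ≤ (q : ℝ) → (g x).re ≤ (q : ℝ) := by
    intro q hqx
    have hmem : (((q - x : ℝ)) : ℂ) ∈ ecl (∅ : Set ℂ) := by
      rw [Complex.ofReal_sub]; exact sub_mem_ecl_empty (hq q) hx
    have h := coreAut_re_nonneg_of_real hg hreal hmem (sub_nonneg.2 hqx)
    have hgx : g ((q - x : ℝ) : ℂ) = ((q : ℝ) : ℂ) - g x := by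
      rw [Complex.ofReal_sub, sub_eq_add_neg, hg.map_add (hq q) (Khovanskii.neg_mem_ecl hx),
        hg.map_neg hx, hgq q, ← sub_eq_add_neg]
    rw [hgx, Complex.sub_re, Complex.ofReal_re] at h
    linarith
  have hre : (g x).re = x := by
    by_contra hne
    rcases lt_or_gt_of_ne hne with hlt | hgt
    · obtain ⟨q, hq1, hq2⟩ := exists_rat_btwn hlt
      exact absurd (hlow q hq2.le) (not_le.2 hq1)
    · obtain ⟨q, hq1, hq2⟩ := exists_rat_btwn hgt
      exact absurd (hupp q hq1.le) (not_le.2 hq2)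
  exact Complex.ext (by simpa using hre) (by simpa using hreal x hx)

/-- **Tame core automorphisms are trivial**: a core automorphism that maps real elements of `C₀`
to real numbers is the identity or complex conjugation on `C₀`. -/
theorem coreAut_eqOn_id_or_conj_of_real (hg : IsEIsoOn g (ecl (∅ : Set ℂ)) (ecl (∅ : Set ℂ)))
    (hreal : ∀ x : ℝ, (x : ℂ) ∈ ecl (∅ : Set ℂ) → (g x).im = 0) :
    Set.EqOn g id (ecl (∅ : Set ℂ)) ∨ Set.EqOn g (starRingEnd ℂ) (ecl (∅ : Set ℂ)) := by
  have key : ∀ a ∈ ecl (∅ : Set ℂ), g a = (a.re : ℂ) + (a.im : ℂ) * g Complex.I := by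
    intro a ha
    have hre := coreAut_ofReal_eq_self_of_real hg hreal (ofReal_re_mem_ecl_empty ha)
    have him := coreAut_ofReal_eq_self_of_real hg hreal (ofReal_im_mem_ecl_empty ha)
    calc g a = g ((a.re : ℂ) + (a.im : ℂ) * Complex.I) := by rw [Complex.re_add_im]
      _ = g (a.re : ℂ) + g (a.im : ℂ) * g Complex.I := by
          rw [hg.map_add (ofReal_re_mem_ecl_empty ha)
              (Khovanskii.mul_mem_ecl (ofReal_im_mem_ecl_empty ha) I_mem_ecl_empty),
            hg.map_mul (ofReal_im_mem_ecl_empty ha) I_mem_ecl_empty]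
      _ = (a.re : ℂ) + (a.im : ℂ) * g Complex.I := by rw [hre, him]
  rcases coreAut_map_two_pi_I_and_map_I hg with ⟨-, hI⟩ | ⟨-, hI⟩
  · left
    intro a ha
    rw [key a ha, hI, Complex.re_add_im]; rfl
  · right
    intro a ha
    rw [key a ha, hI]
    apply Complex.ext <;> simp

/-- Unconditionally: either every core automorphism is `id` or `conj` on `C₀`, or some core
automorphism maps a REAL exponentially algebraic number to a NON-REAL one (a "wild" automorphism). -/
theorem coreAut_rigid_or_exists_wild :
    (∀ g : ℂ → ℂ, IsEIsoOn g (ecl (∅ : Set ℂ)) (ecl (∅ : Set ℂ)) →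
        Set.EqOn g id (ecl (∅ : Set ℂ)) ∨ Set.EqOn g (starRingEnd ℂ) (ecl (∅ : Set ℂ))) ∨
      ∃ g : ℂ → ℂ, IsEIsoOn g (ecl (∅ : Set ℂ)) (ecl (∅ : Set ℂ)) ∧
        ∃ x : ℝ, (x : ℂ) ∈ ecl (∅ : Set ℂ) ∧ (g x).im ≠ 0 := by
  by_cases hrig : ∀ g : ℂ → ℂ, IsEIsoOn g (ecl (∅ : Set ℂ)) (ecl (∅ : Set ℂ)) →
      Set.EqOn g id (ecl (∅ : Set ℂ)) ∨ Set.EqOn g (starRingEnd ℂ) (ecl (∅ : Set ℂ))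
  · exact Or.inl hrig
  · right
    push Not at hrig
    obtain ⟨g, hg, hne⟩ := hrig
    refine ⟨g, hg, ?_⟩
    by_contra hall
    push Not at hall
    rcases coreAut_eqOn_id_or_conj_of_real hg hall with h | h
    · exact hne.1 h
    · exact hne.2 h

end CoreAut

/-! ## §3 The rigidity dichotomy for the residue stub -/

/-- `C₀ ⊆ C_EA` trivially implies the residue stub. -/
theorem stubCoreFixedField_of_ecl_subset (h : ecl (∅ : Set ℂ) ⊆ (logFreeCore : Set ℂ)) :
    ∀ a ∈ ecl (∅ : Set ℂ),
      (∀ g : ℂ → ℂ, IsEIsoOn g (ecl (∅ : Set ℂ)) (ecl (∅ : Set ℂ)) → g a = a) →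
        a ∈ (logFreeCore : Set ℂ) :=
  fun _ ha _ => h ha

/-- **Rigidity dichotomy.** If every core automorphism is `id` or `conj` on `C₀` (no automorphism of
`C₀` beyond these two is known), the residue stub `stub_coreFixedField_logFree` is EQUIVALENT to
`C₀ ⊆ C_EA` ("every exponentially algebraic number is log-free", false under SC, §4). -/
theorem stubCoreFixedField_iff_of_rigid
    (hrig : ∀ g : ℂ → ℂ, IsEIsoOn g (ecl (∅ : Set ℂ)) (ecl (∅ : Set ℂ)) →
      Set.EqOn g id (ecl (∅ : Set ℂ)) ∨ Set.EqOn g (starRingEnd ℂ) (ecl (∅ : Set ℂ))) :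
    (∀ a ∈ ecl (∅ : Set ℂ),
      (∀ g : ℂ → ℂ, IsEIsoOn g (ecl (∅ : Set ℂ)) (ecl (∅ : Set ℂ)) → g a = a) →
        a ∈ (logFreeCore : Set ℂ)) ↔
      ecl (∅ : Set ℂ) ⊆ (logFreeCore : Set ℂ) := by
  refine ⟨fun h => ?_, stubCoreFixedField_of_ecl_subset⟩
  rw [ecl_subset_logFreeCore_iff_real]
  intro a ha him
  refine h a ha fun g hg => ?_
  rcases hrig g hg with hid | hconj
  · exact hid ha
  · rw [hconj ha]; exact Complex.conj_eq_iff_im.2 him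

/-- **Price of the residue stub**: it implies that EITHER `C₀ = C_EA` (SC-false, §4) OR some
E-field automorphism of the countable core maps a real exponentially algebraic number to a non-real
one.  Granting SC, a proof of the stub is a construction of such a wild automorphism. -/
theorem ecl_subset_logFreeCore_or_exists_wild_of_stub
    (h : ∀ a ∈ ecl (∅ : Set ℂ),
      (∀ g : ℂ → ℂ, IsEIsoOn g (ecl (∅ : Set ℂ)) (ecl (∅ : Set ℂ)) → g a = a) →
        a ∈ (logFreeCore : Set ℂ)) :
    ecl (∅ : Set ℂ) = (logFreeCore : Set ℂ) ∨
      ∃ g : ℂ → ℂ, IsEIsoOn g (ecl (∅ : Set ℂ)) (ecl (∅ : Set ℂ)) ∧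
        ∃ x : ℝ, (x : ℂ) ∈ ecl (∅ : Set ℂ) ∧ (g x).im ≠ 0 := by
  rcases coreAut_rigid_or_exists_wild with hrig | hwild
  · exact Or.inl (ecl_subset_logFreeCore_iff_eq.1 ((stubCoreFixedField_iff_of_rigid hrig).1 h))
  · exact Or.inr hwild

/-- Conversely a wild automorphism certifies, through the stub, nothing about `C₀ = C_EA`; but it IS
what the stub needs pointwise: an element of `C₀ ∖ C_EA` must be moved, and (being real or having a
real or imaginary part outside `C_EA`) some REAL element of `C₀ ∖ C_EA` must be moved off itself. -/
theorem exists_real_moved_of_stub_of_not_mem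
    (h : ∀ a ∈ ecl (∅ : Set ℂ),
      (∀ g : ℂ → ℂ, IsEIsoOn g (ecl (∅ : Set ℂ)) (ecl (∅ : Set ℂ)) → g a = a) →
        a ∈ (logFreeCore : Set ℂ))
    {a : ℂ} (ha : a ∈ ecl (∅ : Set ℂ)) (hna : a ∉ logFreeCore) :
    ∃ x : ℝ, (x : ℂ) ∈ ecl (∅ : Set ℂ) ∧ (x : ℂ) ∉ logFreeCore ∧
      ∃ g : ℂ → ℂ, IsEIsoOn g (ecl (∅ : Set ℂ)) (ecl (∅ : Set ℂ)) ∧ g x ≠ x := by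
  classical
  have hparts : ((a.re : ℝ) : ℂ) ∉ logFreeCore ∨ ((a.im : ℝ) : ℂ) ∉ logFreeCore := by
    by_contra hcon
    push Not at hcon
    exact hna (mem_logFreeCore_of_re_im hcon.1 hcon.2)
  rcases hparts with hx | hx
  · refine ⟨a.re, ofReal_re_mem_ecl_empty ha, hx, ?_⟩
    by_contra hall
    push Not at hall
    exact hx (h _ (ofReal_re_mem_ecl_empty ha) hall)
  · refine ⟨a.im, ofReal_im_mem_ecl_empty ha, hx, ?_⟩
    by_contra hall
    push Not at hall
    exact hx (h _ (ofReal_im_mem_ecl_empty ha) hall)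

/-! ## §4 The SC-witness against `C₀ = C_EA` lives in `C₀`: the real solution of `eˣ = -x` -/

/-- Every solution of `e^a + a = 0` is exponentially algebraic (Khovanskii system `Y + X = 0` in one
unknown; its Jacobian `1 + e^a` vanishes only if `e^a = -1`, `a = 1`, which is absurd). -/
theorem mem_ecl_empty_of_exp_add_self_eq_zero {a : ℂ} (h : Complex.exp a + a = 0) :
    a ∈ ecl (∅ : Set ℂ) := by
  classical
  refine mem_ecl_empty_of_isExpAlgebraic
    (IsExpAlgebraic.of_solution_one (X (Sum.inr 0) + X (Sum.inl 0)) ?_ ?_ ?_)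
  · intro mo
    rw [coeff_add, coeff_X, coeff_X]
    split_ifs
    · exact ⟨2, by push_cast; ring⟩
    · exact ⟨1, by push_cast; ring⟩
    · exact ⟨1, by push_cast; ring⟩
    · exact ⟨0, by push_cast; ring⟩
  · simpa using h
  · have hder : MvPolynomial.eval (Sum.elim (fun _ : Fin 1 => a) fun _ : Fin 1 => Complex.exp a)
        (pderiv (Sum.inl 0) (X (Sum.inr 0) + X (Sum.inl 0) : MvPolynomial (Fin 1 ⊕ Fin 1) ℂ) +
          X (Sum.inr 0) * pderiv (Sum.inr 0) (X (Sum.inr 0) + X (Sum.inl 0))) =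
        1 + Complex.exp a := by
      simp [pderiv_X]
    rw [hder]
    intro h1
    have ha1 : a = 1 := by linear_combination h - h1
    rw [ha1] at h1
    have h2 := congrArg Complex.re h1
    simp [Complex.exp_re] at h2
    linarith [Real.exp_pos 1]

/-- **The witness.** There is a real exponentially algebraic number `x₀ < 0` with `e^{x₀} = -x₀`
(`x₀ = -Ω`, `Ω = W(1) = 0.567143…`); under Schanuel's conjecture `x₀ ∉ K_ω = C_EA` (module
docstring), so `C₀ ≠ C_EA` and the first alternative of
`ecl_subset_logFreeCore_or_exists_wild_of_stub` is SC-false. -/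
theorem exists_real_exp_add_self_eq_zero_mem_ecl_empty :
    ∃ x : ℝ, x < 0 ∧ Real.exp x + x = 0 ∧ (x : ℂ) ∈ ecl (∅ : Set ℂ) := by
  have hcont : ContinuousOn (fun x : ℝ => Real.exp x + x) (Set.Icc (-1) 0) :=
    (Real.continuous_exp.add continuous_id).continuousOn
  have hmem : (0 : ℝ) ∈ Set.Icc (Real.exp (-1) + (-1)) (Real.exp 0 + 0) := by
    refine ⟨?_, by simp⟩
    have h1 : Real.exp (-1) < Real.exp 0 := Real.exp_lt_exp.2 (by norm_num)
    rw [Real.exp_zero] at h1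
    linarith
  obtain ⟨x, hxI, hx⟩ := intermediate_value_Icc (by norm_num) hcont hmem
  have hx0 : x < 0 := by
    rcases eq_or_lt_of_le hxI.2 with h0 | h0
    · subst h0; simp at hx
    · exact h0
  refine ⟨x, hx0, hx, mem_ecl_empty_of_exp_add_self_eq_zero ?_⟩
  have := congrArg (fun r : ℝ => (r : ℂ)) hx
  simpa [Complex.ofReal_exp] using this

end Summit.Schanuel.Schanuel.Theorems.AclSubsetLogFreeCore.Negative
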